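import Summits.MatrixMultiplication.MatrixMultiplication.Theses.HiddenToeplitzCorners
import Summits.MatrixMultiplication.MatrixMultiplication.Theorems.HiddenToeplitzCornersHiddenCornerLemmaRHConst

/-!
# Line `frobenius-dual-short-syzygies` for crux `HiddenCornerLemmaR` (stmt-MatrixMultiplication-10752)

Crux-plan seat `planner-cruxplan-stmt-MatrixMultiplication-10752-frobenius-dual-short-0`, 2026-08-16.
Line card: `Lines/frobenius-dual-short-syzygies.md`; this file is stored as `Lines/frobenius_dual_short_syzygies.lean` (hyphens are not module characters) (same directory).  Idea card:
`Ideas/frobenius-dual-short-syzygies.md` (triage r1: pass ×2).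

Notation used in the docstrings (everything is written out verbatim in the statements):
`Z` = the lower shift on `ℂ^N` (`Z i j = [i = j+1]`, exactly as in the crux), `∇M = M − Z M Zᵀ` the
Stein displacement, `T(X) = Σ_ab X_ab • T a b` the pencil, `L(v) = Σ_i v_i Z^i` (lower-triangular
Toeplitz = multiplication by `v` in `ℂ[s]/(s^N)`), `U(v) = Σ_i v_i (Zᵀ)^i = L(v)ᵀ` (correlation:
`(U(v) x)_n = Σ_i v_i x_{n+i}`).  A pencil is in the `(p,q)`-COMPRESSION CLASS when every coefficient
has split displacement `∇(T a b) = G₀ (H₁ a b)ᵀ + (G₁ a b) H₀ᵀ` with CONSTANT `G₀ : N × p`,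
`H₀ : N × q`; `q = 0` is the G-constant class (`T a b = Σ_k L(g_k) U(h_k)`, `g_k` = columns of `G₀`),
`p = 0` the H-constant class (landed: `hclR_hconst_bound`, `r ≤ q`).

## The line (four registered stubs + kernel-checked composition)

* `stub_compressionReduction` (S1, transfer-in, L): the compression classes decide the crux — if every
  generically nonsingular corner-hiding pencil of class `(p,q)` has `r ≤ 2p + q`, then
  `HiddenCornerLemmaR`.  Content: Atkinson–Lloyd normal form of the `r²`-dimensional displacement
  space (all ranks `≤ d`) transported through `∇⁻¹` (constant outer factors, `p + q + ρ ≤ d`) plus the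
  exclusion / pricing of primitive cores (Atkinson: core window `≤ ρ(ρ+1)/2`; none for `d ≤ 2`).
* `stub_dualityAnnihilator` (S2, THE LEVER, provable now, M): in the G-constant class the residue
  pairing of `ℂ[s]/(s^N)` computes the annihilator of the image of `h ↦ (Σ_k L(g_k)U(h_k) e_c)_c`
  EXPLICITLY: `Λ ⊥ image ⇔ ∀ k, Σ_c U(U(g_k) λ_c) e_c = 0` (all correlates of `Λ` are syzygies of
  the frame).  Hence a corner family forces `Λᵀ F = 0` for every such `Λ` — the targets `F` are OUTPUT.
* `stub_gconstDualLaw` (S3, HARDEST, the card's transfer `C⁺`, XL): with `T` and the family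
  ELIMINATED — data = generators `G₀`, frame `E`, target frame `F` orthogonal to the explicit
  annihilator, and ONE invertible matrix `M` of the class mapping `E` into `F` — conclude `r ≤ 2p`.
  Equivalent to the crux restricted to the G-constant class (an invertible `M` lies in the affine
  completion family `V + K(E)` and re-centres the pencil); tight to within one (W-family `r = 2p−1`,
  all `p`); nonsingularity is load-bearing (pure deficiency counting is refuted at `(r,N,p) = (5,25,2)`,
  see the line card).
* `stub_mixedLaw` (S4, L): mixed classes `p, q ≥ 1`: `r ≤ 2p + q` (H-part priced by the landed
  relative-visibility dichotomy `hclR_relvis_bound`, G-part below the cut by S3-type arguments).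
* `HiddenCornerLemmaR_of : HiddenCornerLemmaR` — real proof from the four stubs invoked BY NAME (no
  `sorry` of its own): S1 reduces to the compression classes; `q = 0` is S2 then S3 applied to
  `M := T(X₀)`; `p = 0` is the landed `hclR_hconst_bound`; `p, q ≥ 1` is S4.

Disproof.lean: none exists for this crux at write time (`ledger crux cat … Disproof.lean`: no
workfile).  Honoured instead: the recorded refutation of the unguarded lemma (stmt-7493, `(3,9,1)`,
`det ≡ 0`) and triage facts N1/N2 — S3 carries `M.det ≠ 0` and S4 the nonsingular value; no stub uses
diagonal data only (N1: circulants) or the F-side shift defect (N2: `α_F = r` occurs); no stub is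
`ImageFrameDefect` or `HCLRDiag` (line `Sketch` died there).
-/

set_option linter.dupNamespace false
set_option linter.unusedVariables false

namespace Summit.MatrixMultiplication.MatrixMultiplication.Cruxes.HiddenCornerLemmaR.FrobeniusDualShortSyzygies

open scoped Matrix BigOperators
open Summit.MatrixMultiplication.MatrixMultiplication.Theses.HiddenToeplitzCorners (HiddenCornerLemmaR)
open Summit.MatrixMultiplication.MatrixMultiplication.Theorems (hclR_hconst_bound)

/-! ## § 1  The four registered stubs -/

/-- **S1 · `stub_compressionReduction`** (transfer-in; difficulty L; sources AtkinsonLloyd1981 Thm 1,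
Atkinson1983 Thm B = arXiv:1211.5118 Thm 1, EisenbudHarris1988, KailathKungMorf1979).
*The compression classes decide the crux.*  If every pencil `T` whose coefficient matrices have split
Stein displacement `∇(T a b) = G₀ (H₁ a b)ᵀ + (G₁ a b) H₀ᵀ` with CONSTANT `G₀ : N × p` and
`H₀ : N × q`, hiding a linearly explained corner `T(X) E = F X` (`rank E = rank F = r`) and generically
nonsingular, satisfies `r ≤ 2p + q`, then `HiddenCornerLemmaR` holds.  Proof route: the displacement
space `{∇T(X)}` is an `r²`-dimensional space of matrices of rank `≤ d`; Atkinson–Lloyd normal form gives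
constant `P, Q` with `P·{∇T(X)}·Q ⊆` (`p` full rows) `+` (`q` full columns) `+` (primitive core of rank
`ρ`), `p + q + ρ ≤ d`, and `∇⁻¹(g hᵀ) = L(g) U(h)` transports this to the split form with constant outer
factors; for `d ≤ 2` there is no core (`r² ≥ 4 > 3 = dim Alt₃`), in general the core (window
`≤ ρ(ρ+1)/2`, Atkinson) must be shown not to carry a corner within the rank budget.
Why it might fail: an economical hidden corner (`r > 2d`) whose displacement space has a genuinely
primitive component riding within the rank budget (only possible for `d ≥ 3`). -/
theorem stub_compressionReduction :
    (∀ (r N p q : ℕ) (T : Fin r → Fin r → Matrix (Fin N) (Fin N) ℂ) (E F : Matrix (Fin N) (Fin r) ℂ)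
        (G₀ : Matrix (Fin N) (Fin p) ℂ) (H₀ : Matrix (Fin N) (Fin q) ℂ)
        (H₁ : Fin r → Fin r → Matrix (Fin N) (Fin p) ℂ) (G₁ : Fin r → Fin r → Matrix (Fin N) (Fin q) ℂ),
        E.rank = r → F.rank = r →
        (∀ X : Matrix (Fin r) (Fin r) ℂ, (∑ a : Fin r, ∑ b : Fin r, X a b • T a b) * E = F * X) →
        (∀ a b, T a b - (Matrix.of fun i j : Fin N => if (i : ℕ) = (j : ℕ) + 1 then (1 : ℂ) else 0) * T a b *
            (Matrix.of fun i j : Fin N => if (i : ℕ) = (j : ℕ) + 1 then (1 : ℂ) else 0)ᵀ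
            = G₀ * (H₁ a b)ᵀ + G₁ a b * H₀ᵀ) →
        (∃ X₀ : Matrix (Fin r) (Fin r) ℂ, (∑ a : Fin r, ∑ b : Fin r, X₀ a b • T a b).det ≠ 0) →
        r ≤ 2 * p + q) →
    HiddenCornerLemmaR := by
  sorry

/-- **S2 · `stub_dualityAnnihilator`** (THE LEVER; provable now; difficulty M; sources
KailathKungMorf1979 (generator form `∇⁻¹(g hᵀ) = L(g)U(h)`), HeinigRost1984 ch. 5, BeckermannLabahn1994).
In the G-constant class (`∇(T a b) = G₀ (H₁ a b)ᵀ`, so `T a b = Σ_k L(g_k) U(h_{k,ab})` by Stein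
inversion, `g_k` = column `k` of `G₀`) the corner map `h ↦ (Σ_k L(g_k) U(h_k) e_c)_c` has, under the
residue (trace) pairing `⟨Λ, y⟩ = Σ_c λ_c ⬝ y_c`, the EXPLICIT annihilator
`{Λ : ∀ k, Σ_c U(U(g_k) λ_c) e_c = 0}` (use `U(h) e = Hankel(e) h`, `Hankel(e)ᵀ = Hankel(e)`,
`L(g)ᵀ = U(g)`): all `g_k`-correlates of `Λ` are syzygies of the frame.  Consequently, if the pencil
hides the corner `T(X) E = F X`, every such `Λ` kills the targets: `Λᵀ F = 0`.  (Verified numerically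
in the seat folder, exp/check_duality.py: `dim Ann + dim im = N r`, `Ann ⊥ im`, dense and sparse data.)
Why it might fail: it cannot (finite-dimensional duality + two Toeplitz identities); the risk is only
the size of the `Fin N` index bookkeeping. -/
theorem stub_dualityAnnihilator :
    ∀ (r N p : ℕ) (T : Fin r → Fin r → Matrix (Fin N) (Fin N) ℂ) (E F : Matrix (Fin N) (Fin r) ℂ)
      (G₀ : Matrix (Fin N) (Fin p) ℂ) (H₁ : Fin r → Fin r → Matrix (Fin N) (Fin p) ℂ),
      (∀ X : Matrix (Fin r) (Fin r) ℂ, (∑ a : Fin r, ∑ b : Fin r, X a b • T a b) * E = F * X) →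
      (∀ a b, T a b - (Matrix.of fun i j : Fin N => if (i : ℕ) = (j : ℕ) + 1 then (1 : ℂ) else 0) * T a b *
          (Matrix.of fun i j : Fin N => if (i : ℕ) = (j : ℕ) + 1 then (1 : ℂ) else 0)ᵀ = G₀ * (H₁ a b)ᵀ) →
      ∀ Λ : Matrix (Fin N) (Fin r) ℂ,
        (∀ k : Fin p,
          (∑ c : Fin r,
            (∑ j : Fin N,
              (((∑ i : Fin N, G₀ i k •
                  (Matrix.of fun i j : Fin N => if (i : ℕ) = (j : ℕ) + 1 then (1 : ℂ) else 0)ᵀ ^ (i : ℕ))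
                *ᵥ (Λᵀ c)) j) •
              (Matrix.of fun i j : Fin N => if (i : ℕ) = (j : ℕ) + 1 then (1 : ℂ) else 0)ᵀ ^ (j : ℕ))
            *ᵥ (Eᵀ c)) = 0) →
        Λᵀ * F = 0 := by
  sorry

/-- **S3 · `stub_gconstDualLaw`** (HARDEST — the card's transfer `C⁺`; difficulty XL; sources: the
card, BeckermannLabahn1994 (order bases / σ-bases for the band count), HeinigRost1984, rattack-10752
witnesses W1/W2 (tightness `r = 2p − 1`), Flanders1962 / arXiv:1002.1732 (preserver background)).
*Dual G-constant law, pencil and family eliminated.*  Data: constant generators `G₀ : N × p`, a frame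
`E` and a target frame `F` of rank `r` such that `F` is killed by the explicit annihilator of S2
(equivalently, by S2's duality: EVERY `f ∈ im F` is a feasible target for EVERY slot — the deficiency
condition `def(E, G₀) ≥ r` of the card with `im F ⊆ (JΠ)^⊥`), and ONE matrix `M` of the class
(`∇M = G₀ Hᵀ`) which is invertible and maps the frame into the targets (`M E = F X₀`).  Conclusion:
`r ≤ 2p`.  This is equivalent to the crux restricted to the G-constant class: `M E = F X₀` with `M`
invertible forces `X₀` invertible, `K₀ := M − T(X₀)` annihilates `E`, and `T a b + c_ab K₀`
(`Σ c_ab X₀,ab = 1`) is a pencil of the class with the same corner and the nonsingular value `M`.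
Tight to within one for every `p` (W-family: `N = r²`, `g_k = s^{k(2r−2)}`, comb frame, `r = 2p−1`,
verified `p = 2,3,4`).  The invertibility of `M` is LOAD-BEARING: the orthogonality condition alone
(pure deficiency counting, even with `g₁ = 1`) is refuted at `(r,N,p) = (5,25,2)` — `g = (1, s⁵)`,
`E = comb (4,9,14,19,24)`, `def = 5`, every completion of rank `≤ 5` (seat folder exp/junkband.py;
the lead's "junk band").  First milestones inside this stub (supports, not stubs): the toric band law
`def = Σ_j a(w_j)` (graded case, `r ≤ 2p − 1` modulo junk bands — the lead's capacity law) and the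
non-graded `p = 2, r = 4` case.
Why it might fail: it is the open core of the crux (non-graded G-constant designs exist and smoothing
is real at `r = 3`; a nonsingular `(r,p) = (5,2)` design would refute the crux itself). -/
theorem stub_gconstDualLaw :
    ∀ (r N p : ℕ) (G₀ : Matrix (Fin N) (Fin p) ℂ) (E F : Matrix (Fin N) (Fin r) ℂ)
      (M : Matrix (Fin N) (Fin N) ℂ) (H : Matrix (Fin N) (Fin p) ℂ) (X₀ : Matrix (Fin r) (Fin r) ℂ),
      E.rank = r → F.rank = r →
      (∀ Λ : Matrix (Fin N) (Fin r) ℂ,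
        (∀ k : Fin p,
          (∑ c : Fin r,
            (∑ j : Fin N,
              (((∑ i : Fin N, G₀ i k •
                  (Matrix.of fun i j : Fin N => if (i : ℕ) = (j : ℕ) + 1 then (1 : ℂ) else 0)ᵀ ^ (i : ℕ))
                *ᵥ (Λᵀ c)) j) •
              (Matrix.of fun i j : Fin N => if (i : ℕ) = (j : ℕ) + 1 then (1 : ℂ) else 0)ᵀ ^ (j : ℕ))
            *ᵥ (Eᵀ c)) = 0) →
        Λᵀ * F = 0) →
      M - (Matrix.of fun i j : Fin N => if (i : ℕ) = (j : ℕ) + 1 then (1 : ℂ) else 0) * M *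
          (Matrix.of fun i j : Fin N => if (i : ℕ) = (j : ℕ) + 1 then (1 : ℂ) else 0)ᵀ = G₀ * Hᵀ →
      M * E = F * X₀ →
      M.det ≠ 0 →
      r ≤ 2 * p := by
  sorry

/-- **S4 · `stub_mixedLaw`** (difficulty L; sources: compression-normal-form card (class inequality),
the landed `hclR_relvis_bound` (a target visible above the G-cut forces `r ≤ q`), AtkinsonLloyd1981,
triage-2 census of the `(1,1)` class (no `r = 3` design, `N ≤ 10` local + kit j018300)).
*Mixed compression classes.*  For `p ≥ 1` constant left generators AND `q ≥ 1` constant right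
generators, a generically nonsingular corner-hiding pencil has `r ≤ 2p + q` ("a constant left
generator is worth two frame vectors, a constant right generator one").  `q`-part: the relative
visibility dichotomy (landed) gives `r ≤ q` unless every target lies below the G-cut
`c₀ = min_k val(g_k)`; below the cut the pencil is G-constant modulo the H-part and S3-type (dual)
arguments apply.  The case `p = 0` is the landed `hclR_hconst_bound` and is NOT part of this stub.
Why it might fail: synergy between the two parts below the G-cut (the H-part still acts there), i.e.
a mixed design beating additivity; untested beyond `(p,q) = (1,1)`, `r = 3`, `N ≤ 14`. -/
theorem stub_mixedLaw :
    ∀ (r N p q : ℕ) (T : Fin r → Fin r → Matrix (Fin N) (Fin N) ℂ) (E F : Matrix (Fin N) (Fin r) ℂ)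
      (G₀ : Matrix (Fin N) (Fin p) ℂ) (H₀ : Matrix (Fin N) (Fin q) ℂ)
      (H₁ : Fin r → Fin r → Matrix (Fin N) (Fin p) ℂ) (G₁ : Fin r → Fin r → Matrix (Fin N) (Fin q) ℂ),
      0 < p → 0 < q → E.rank = r → F.rank = r →
      (∀ X : Matrix (Fin r) (Fin r) ℂ, (∑ a : Fin r, ∑ b : Fin r, X a b • T a b) * E = F * X) →
      (∀ a b, T a b - (Matrix.of fun i j : Fin N => if (i : ℕ) = (j : ℕ) + 1 then (1 : ℂ) else 0) * T a b *
          (Matrix.of fun i j : Fin N => if (i : ℕ) = (j : ℕ) + 1 then (1 : ℂ) else 0)ᵀ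
          = G₀ * (H₁ a b)ᵀ + G₁ a b * H₀ᵀ) →
      (∃ X₀ : Matrix (Fin r) (Fin r) ℂ, (∑ a : Fin r, ∑ b : Fin r, X₀ a b • T a b).det ≠ 0) →
      r ≤ 2 * p + q := by
  sorry

/-! ## § 2  Glue (fully proved): displacement of an evaluated G-constant pencil -/

/-- Displacement is linear: if every coefficient has `∇(T a b) = G₀ (H₁ a b)ᵀ`, then
`∇T(X) = G₀ (Σ X_ab • H₁ a b)ᵀ`. -/
theorem disp_eval_gconst {r N p : ℕ} (T : Fin r → Fin r → Matrix (Fin N) (Fin N) ℂ)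
    (G₀ : Matrix (Fin N) (Fin p) ℂ) (H₁ : Fin r → Fin r → Matrix (Fin N) (Fin p) ℂ)
    (hdisp : ∀ a b, T a b - (Matrix.of fun i j : Fin N => if (i : ℕ) = (j : ℕ) + 1 then (1 : ℂ) else 0) * T a b *
        (Matrix.of fun i j : Fin N => if (i : ℕ) = (j : ℕ) + 1 then (1 : ℂ) else 0)ᵀ = G₀ * (H₁ a b)ᵀ)
    (X : Matrix (Fin r) (Fin r) ℂ) :
    (∑ a : Fin r, ∑ b : Fin r, X a b • T a b) -
        (Matrix.of fun i j : Fin N => if (i : ℕ) = (j : ℕ) + 1 then (1 : ℂ) else 0) *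
          (∑ a : Fin r, ∑ b : Fin r, X a b • T a b) *
          (Matrix.of fun i j : Fin N => if (i : ℕ) = (j : ℕ) + 1 then (1 : ℂ) else 0)ᵀ
      = G₀ * (∑ a : Fin r, ∑ b : Fin r, X a b • H₁ a b)ᵀ := by
  set Z : Matrix (Fin N) (Fin N) ℂ :=
    Matrix.of fun i j : Fin N => if (i : ℕ) = (j : ℕ) + 1 then (1 : ℂ) else 0 with hZ
  have e1 : Z * (∑ a : Fin r, ∑ b : Fin r, X a b • T a b) * Zᵀ =
      ∑ a : Fin r, ∑ b : Fin r, X a b • (Z * T a b * Zᵀ) := by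
    simp only [Matrix.mul_sum, Matrix.sum_mul, Matrix.mul_smul, Matrix.smul_mul]
  have e2 : G₀ * (∑ a : Fin r, ∑ b : Fin r, X a b • H₁ a b)ᵀ =
      ∑ a : Fin r, ∑ b : Fin r, X a b • (G₀ * (H₁ a b)ᵀ) := by
    simp only [Matrix.transpose_sum, Matrix.transpose_smul, Matrix.mul_sum, Matrix.mul_smul]
  rw [e1, e2, ← Finset.sum_sub_distrib]
  refine Finset.sum_congr rfl fun a _ => ?_
  rw [← Finset.sum_sub_distrib]
  refine Finset.sum_congr rfl fun b _ => ?_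
  rw [← smul_sub, hdisp a b]

/-! ## § 3  Composition (kernel-checked, no `sorry` of its own): the four stubs imply the crux BY NAME -/

/-- **The skeleton theorem** `HiddenCornerLemmaR_of : HiddenCornerLemmaR`, proved from the four
registered stubs invoked BY NAME (the shape `ledger skeleton check` registers; its only `sorry`s are
the stubs').  `stub_compressionReduction` (S1) reduces the crux to the compression classes `(p,q)`;
there, `q = 0` (G-constant) is the duality `stub_dualityAnnihilator` (S2) feeding the dual law
`stub_gconstDualLaw` (S3) at `M := T(X₀)` (glue `disp_eval_gconst`), `p = 0` (H-constant) is the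
LANDED `hclR_hconst_bound` (`r ≤ q`; it needs only `F ≠ 0`, which `rank F = r ≥ 1` gives), and
`p, q ≥ 1` is `stub_mixedLaw` (S4). -/
theorem HiddenCornerLemmaR_of : HiddenCornerLemmaR := by
  refine stub_compressionReduction ?_
  intro r N p q T E F G₀ H₀ H₁ G₁ hE hF hcorner hdisp hns
  rcases Nat.eq_zero_or_pos q with hq | hq
  · -- G-constant class: duality (S2) feeds the dual law (S3) at the nonsingular value M := T(X₀)
    subst hq
    have hdisp' : ∀ a b, T a b - (Matrix.of fun i j : Fin N => if (i : ℕ) = (j : ℕ) + 1 then (1 : ℂ) else 0) *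
        T a b * (Matrix.of fun i j : Fin N => if (i : ℕ) = (j : ℕ) + 1 then (1 : ℂ) else 0)ᵀ
        = G₀ * (H₁ a b)ᵀ := by
      intro a b
      rw [hdisp a b]
      have h0 : G₁ a b * H₀ᵀ = 0 := by
        ext i j
        simp [Matrix.mul_apply]
      rw [h0, add_zero]
    obtain ⟨X₀, hX₀⟩ := hns
    have horth := stub_dualityAnnihilator r N p T E F G₀ H₁ hcorner hdisp'
    have hM := disp_eval_gconst T G₀ H₁ hdisp' X₀
    have hle : r ≤ 2 * p :=
      stub_gconstDualLaw r N p G₀ E F (∑ a : Fin r, ∑ b : Fin r, X₀ a b • T a b)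
        (∑ a : Fin r, ∑ b : Fin r, X₀ a b • H₁ a b) X₀ hE hF horth hM (hcorner X₀) hX₀
    omega
  · rcases Nat.eq_zero_or_pos p with hp | hp
    · -- H-constant class: landed `hclR_hconst_bound` (r ≤ q), needs only F ≠ 0
      subst hp
      rcases Nat.eq_zero_or_pos r with hr | hr
      · omega
      have hFne : F ≠ 0 := by
        intro h
        rw [h, Matrix.rank_zero] at hF
        omega
      have hdisp' : ∀ a b, T a b - (Matrix.of fun i j : Fin N => if (i : ℕ) = (j : ℕ) + 1 then (1 : ℂ) else 0) *
          T a b * (Matrix.of fun i j : Fin N => if (i : ℕ) = (j : ℕ) + 1 then (1 : ℂ) else 0)ᵀ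
          = G₁ a b * H₀ᵀ := by
        intro a b
        rw [hdisp a b]
        have h0 : G₀ * (H₁ a b)ᵀ = 0 := by
          ext i j
          simp [Matrix.mul_apply]
        rw [h0, zero_add]
      have hle : r ≤ q := hclR_hconst_bound r N q T E F H₀ G₁ hFne hcorner hdisp'
      omega
    · -- mixed classes: S4
      exact stub_mixedLaw r N p q T E F G₀ H₀ H₁ G₁ hp hq hE hF hcorner hdisp hns

end Summit.MatrixMultiplication.MatrixMultiplication.Cruxes.HiddenCornerLemmaR.FrobeniusDualShortSyzygies
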